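import Summits.BirchSwinnertonDyer.BirchSwinnertonDyer.Theorems.Rank2ObservatoryRank2Table
import Summits.BirchSwinnertonDyer.BirchSwinnertonDyer.Theorems.Rank2ObservatoryRank2Rows10a
import Summits.BirchSwinnertonDyer.BirchSwinnertonDyer.Theorems.Rank2ObservatoryRank2Rows10b
import Summits.BirchSwinnertonDyer.BirchSwinnertonDyer.Theorems.Rank2ObservatoryRank2Rows11a
import Summits.BirchSwinnertonDyer.BirchSwinnertonDyer.Theorems.Rank2ObservatoryRank2Rows11b
import Summits.BirchSwinnertonDyer.BirchSwinnertonDyer.Theorems.Rank2ObservatoryRank2Rows12a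
import Summits.BirchSwinnertonDyer.BirchSwinnertonDyer.Theorems.Rank2ObservatoryRank2Rows12b
import Summits.BirchSwinnertonDyer.BirchSwinnertonDyer.Theorems.Rank2ObservatoryRank2Rows13a
import Summits.BirchSwinnertonDyer.BirchSwinnertonDyer.Theorems.Rank2ObservatoryRank2Rows13b
import Summits.BirchSwinnertonDyer.BirchSwinnertonDyer.Theorems.Rank2ObservatoryRank2Rows14a
import Summits.BirchSwinnertonDyer.BirchSwinnertonDyer.Theorems.Rank2ObservatoryRank2Rows14b
import Summits.BirchSwinnertonDyer.BirchSwinnertonDyer.Theorems.Rank2ObservatoryRank2Rows15a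
import Summits.BirchSwinnertonDyer.BirchSwinnertonDyer.Theorems.Rank2ObservatoryRank2Rows15b
import Summits.BirchSwinnertonDyer.BirchSwinnertonDyer.Theorems.Rank2ObservatoryRank2Rows16a
import Summits.BirchSwinnertonDyer.BirchSwinnertonDyer.Theorems.Rank2ObservatoryRank2Rows16b
import Summits.BirchSwinnertonDyer.BirchSwinnertonDyer.Theorems.Rank2ObservatoryRank2Rows17a
import Summits.BirchSwinnertonDyer.BirchSwinnertonDyer.Theorems.Rank2ObservatoryRank2Rows17b
import Summits.BirchSwinnertonDyer.BirchSwinnertonDyer.Theorems.Rank2ObservatoryRank2Rows18a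
import Summits.BirchSwinnertonDyer.BirchSwinnertonDyer.Theorems.Rank2ObservatoryRank2Rows18b
import Summits.BirchSwinnertonDyer.BirchSwinnertonDyer.Theorems.Rank2ObservatoryRank2Rows19a
import Summits.BirchSwinnertonDyer.BirchSwinnertonDyer.Theorems.Rank2ObservatoryRank2Rows19b
import HarnessLib

/-!
# BirchSwinnertonDyer — rank ≥ 2 observatory: rank-2 census table, decade 1 of 10 (`50000 ≤ N < 100000`)

HONEST FRAMING: per-curve certified theorems and census instruments; no claim on BSD in rank ≥ 2.

Machine-written AGGREGATION level of the rank-2 census (schema `Rank2ObservatoryRank2Table.lean`, data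
chunks `Rank2ObservatoryRank2Rows10a … 19b`, census `Rank2ObservatoryRank2Census.lean`): `rank2Decade1` is the
concatenation of the 20 chunks of conductor windows 10–19 (`50000 ≤ N < 100000`; a window above the gate's
200 kB file cap is stored as two half-window chunks `NNa`, `NNb`) — rows 23613–56975 of `rank2_table.tsv`
(sha256 `8b151c933b69ee8dae4834c21efd171353ae94c887716c05b7381d12d173f912`), 33363 curves from `50008g1` to
`99999c1`. Its theorems are assembled from the chunk theorems (each a kernel `decide`) by
`List.all_append` / `List.length_append` rewriting only; no row is re-evaluated here. The two-level
assembly (chunks → decades → table) keeps every file under the tree's 400-line limit and every list short.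

Reference: J. E. Cremona, *Algorithms for Modular Elliptic Curves* (2nd ed. 1997), tables / ecdata.
-/

-- single-conjunct summit: `Summit.BirchSwinnertonDyer.BirchSwinnertonDyer.…` repeats the name by design
set_option linter.dupNamespace false

namespace Summit.BirchSwinnertonDyer.BirchSwinnertonDyer.Rank2Observatory

/-- The 20 chunks of decade 1 (conductors `50000 ≤ N < 100000`), in order. [cite: CremonaAlgorithms1997, Tables] -/
noncomputable def rank2Decade1Chunks : List (List Rank2Row) := [
  rank2Rows10a, rank2Rows10b, rank2Rows11a, rank2Rows11b, rank2Rows12a, rank2Rows12b,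
  rank2Rows13a, rank2Rows13b, rank2Rows14a, rank2Rows14b, rank2Rows15a, rank2Rows15b,
  rank2Rows16a, rank2Rows16b, rank2Rows17a, rank2Rows17b, rank2Rows18a, rank2Rows18b,
  rank2Rows19a, rank2Rows19b]

/-- Decade 1 of the rank-2 census table: the 33363 rank-2 curves of conductor `50000 ≤ N < 100000` (rows 23613–56975).
[cite: CremonaAlgorithms1997, Tables] -/
noncomputable def rank2Decade1 : List Rank2Row :=
  rank2Decade1Chunks.flatten

/-- Every row of decade 1 satisfies `Rank2Row.check` (from the 20 chunk theorems). [folklore] -/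
theorem rank2Decade1_check : rank2Decade1.all Rank2Row.check = true := by
  simp only [rank2Decade1, rank2Decade1Chunks, List.flatten_cons, List.flatten_nil, List.all_append, List.all_nil,
    Bool.and_true,
    rank2Rows10a_check, rank2Rows10b_check, rank2Rows11a_check, rank2Rows11b_check,
    rank2Rows12a_check, rank2Rows12b_check, rank2Rows13a_check, rank2Rows13b_check,
    rank2Rows14a_check, rank2Rows14b_check, rank2Rows15a_check, rank2Rows15b_check,
    rank2Rows16a_check, rank2Rows16b_check, rank2Rows17a_check, rank2Rows17b_check,
    rank2Rows18a_check, rank2Rows18b_check, rank2Rows19a_check, rank2Rows19b_check]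

/-- Decade 1 has `33363` rows (sum of the 20 kernel-counted chunk lengths). [cite: CremonaAlgorithms1997, Tables] -/
theorem rank2Decade1_length : rank2Decade1.length = 33363 := by
  simp only [rank2Decade1, rank2Decade1Chunks, List.flatten_cons, List.flatten_nil, List.length_append, List.length_nil,
    rank2Rows10a_length, rank2Rows10b_length, rank2Rows11a_length, rank2Rows11b_length,
    rank2Rows12a_length, rank2Rows12b_length, rank2Rows13a_length, rank2Rows13b_length,
    rank2Rows14a_length, rank2Rows14b_length, rank2Rows15a_length, rank2Rows15b_length,
    rank2Rows16a_length, rank2Rows16b_length, rank2Rows17a_length, rank2Rows17b_length,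
    rank2Rows18a_length, rank2Rows18b_length, rank2Rows19a_length, rank2Rows19b_length]

/-- Every conductor of decade 1 is `< 500 000` (from the 20 kernel-checked chunk ranges).
[cite: CremonaAlgorithms1997, Tables] -/
theorem rank2Decade1_conductor_lt : rank2Decade1.all (fun r => decide (r.N < 500000)) = true := by
  simp only [rank2Decade1, rank2Decade1Chunks, List.flatten_cons, List.flatten_nil, List.all_append, List.all_nil,
    Bool.and_true,
    Rank2Row.all_conductorLt_of_all_range (by norm_num) rank2Rows10a_conductor,
    Rank2Row.all_conductorLt_of_all_range (by norm_num) rank2Rows10b_conductor,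
    Rank2Row.all_conductorLt_of_all_range (by norm_num) rank2Rows11a_conductor,
    Rank2Row.all_conductorLt_of_all_range (by norm_num) rank2Rows11b_conductor,
    Rank2Row.all_conductorLt_of_all_range (by norm_num) rank2Rows12a_conductor,
    Rank2Row.all_conductorLt_of_all_range (by norm_num) rank2Rows12b_conductor,
    Rank2Row.all_conductorLt_of_all_range (by norm_num) rank2Rows13a_conductor,
    Rank2Row.all_conductorLt_of_all_range (by norm_num) rank2Rows13b_conductor,
    Rank2Row.all_conductorLt_of_all_range (by norm_num) rank2Rows14a_conductor,
    Rank2Row.all_conductorLt_of_all_range (by norm_num) rank2Rows14b_conductor,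
    Rank2Row.all_conductorLt_of_all_range (by norm_num) rank2Rows15a_conductor,
    Rank2Row.all_conductorLt_of_all_range (by norm_num) rank2Rows15b_conductor,
    Rank2Row.all_conductorLt_of_all_range (by norm_num) rank2Rows16a_conductor,
    Rank2Row.all_conductorLt_of_all_range (by norm_num) rank2Rows16b_conductor,
    Rank2Row.all_conductorLt_of_all_range (by norm_num) rank2Rows17a_conductor,
    Rank2Row.all_conductorLt_of_all_range (by norm_num) rank2Rows17b_conductor,
    Rank2Row.all_conductorLt_of_all_range (by norm_num) rank2Rows18a_conductor,
    Rank2Row.all_conductorLt_of_all_range (by norm_num) rank2Rows18b_conductor,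
    Rank2Row.all_conductorLt_of_all_range (by norm_num) rank2Rows19a_conductor,
    Rank2Row.all_conductorLt_of_all_range (by norm_num) rank2Rows19b_conductor]

/-- A row of a chunk of decade 1 is a row of the decade. [folklore] -/
theorem mem_rank2Decade1_of_mem_chunk {l : List Rank2Row} (hl : l ∈ rank2Decade1Chunks) {r : Rank2Row} (hr : r ∈ l) :
    r ∈ rank2Decade1 :=
  List.mem_flatten.mpr ⟨l, hl, hr⟩

/-- Chunk 10a is a chunk of decade 1. [folklore] -/
theorem rank2Rows10a_mem_decade1 : rank2Rows10a ∈ rank2Decade1Chunks :=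
  List.mem_iff_getElem?.mpr ⟨0, rfl⟩

/-- Chunk 10b is a chunk of decade 1. [folklore] -/
theorem rank2Rows10b_mem_decade1 : rank2Rows10b ∈ rank2Decade1Chunks :=
  List.mem_iff_getElem?.mpr ⟨1, rfl⟩

/-- Chunk 11a is a chunk of decade 1. [folklore] -/
theorem rank2Rows11a_mem_decade1 : rank2Rows11a ∈ rank2Decade1Chunks :=
  List.mem_iff_getElem?.mpr ⟨2, rfl⟩

/-- Chunk 11b is a chunk of decade 1. [folklore] -/
theorem rank2Rows11b_mem_decade1 : rank2Rows11b ∈ rank2Decade1Chunks :=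
  List.mem_iff_getElem?.mpr ⟨3, rfl⟩

/-- Chunk 12a is a chunk of decade 1. [folklore] -/
theorem rank2Rows12a_mem_decade1 : rank2Rows12a ∈ rank2Decade1Chunks :=
  List.mem_iff_getElem?.mpr ⟨4, rfl⟩

/-- Chunk 12b is a chunk of decade 1. [folklore] -/
theorem rank2Rows12b_mem_decade1 : rank2Rows12b ∈ rank2Decade1Chunks :=
  List.mem_iff_getElem?.mpr ⟨5, rfl⟩

/-- Chunk 13a is a chunk of decade 1. [folklore] -/
theorem rank2Rows13a_mem_decade1 : rank2Rows13a ∈ rank2Decade1Chunks :=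
  List.mem_iff_getElem?.mpr ⟨6, rfl⟩

/-- Chunk 13b is a chunk of decade 1. [folklore] -/
theorem rank2Rows13b_mem_decade1 : rank2Rows13b ∈ rank2Decade1Chunks :=
  List.mem_iff_getElem?.mpr ⟨7, rfl⟩

/-- Chunk 14a is a chunk of decade 1. [folklore] -/
theorem rank2Rows14a_mem_decade1 : rank2Rows14a ∈ rank2Decade1Chunks :=
  List.mem_iff_getElem?.mpr ⟨8, rfl⟩

/-- Chunk 14b is a chunk of decade 1. [folklore] -/
theorem rank2Rows14b_mem_decade1 : rank2Rows14b ∈ rank2Decade1Chunks :=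
  List.mem_iff_getElem?.mpr ⟨9, rfl⟩

/-- Chunk 15a is a chunk of decade 1. [folklore] -/
theorem rank2Rows15a_mem_decade1 : rank2Rows15a ∈ rank2Decade1Chunks :=
  List.mem_iff_getElem?.mpr ⟨10, rfl⟩

/-- Chunk 15b is a chunk of decade 1. [folklore] -/
theorem rank2Rows15b_mem_decade1 : rank2Rows15b ∈ rank2Decade1Chunks :=
  List.mem_iff_getElem?.mpr ⟨11, rfl⟩

/-- Chunk 16a is a chunk of decade 1. [folklore] -/
theorem rank2Rows16a_mem_decade1 : rank2Rows16a ∈ rank2Decade1Chunks :=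
  List.mem_iff_getElem?.mpr ⟨12, rfl⟩

/-- Chunk 16b is a chunk of decade 1. [folklore] -/
theorem rank2Rows16b_mem_decade1 : rank2Rows16b ∈ rank2Decade1Chunks :=
  List.mem_iff_getElem?.mpr ⟨13, rfl⟩

/-- Chunk 17a is a chunk of decade 1. [folklore] -/
theorem rank2Rows17a_mem_decade1 : rank2Rows17a ∈ rank2Decade1Chunks :=
  List.mem_iff_getElem?.mpr ⟨14, rfl⟩

/-- Chunk 17b is a chunk of decade 1. [folklore] -/
theorem rank2Rows17b_mem_decade1 : rank2Rows17b ∈ rank2Decade1Chunks :=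
  List.mem_iff_getElem?.mpr ⟨15, rfl⟩

/-- Chunk 18a is a chunk of decade 1. [folklore] -/
theorem rank2Rows18a_mem_decade1 : rank2Rows18a ∈ rank2Decade1Chunks :=
  List.mem_iff_getElem?.mpr ⟨16, rfl⟩

/-- Chunk 18b is a chunk of decade 1. [folklore] -/
theorem rank2Rows18b_mem_decade1 : rank2Rows18b ∈ rank2Decade1Chunks :=
  List.mem_iff_getElem?.mpr ⟨17, rfl⟩

/-- Chunk 19a is a chunk of decade 1. [folklore] -/
theorem rank2Rows19a_mem_decade1 : rank2Rows19a ∈ rank2Decade1Chunks :=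
  List.mem_iff_getElem?.mpr ⟨18, rfl⟩

/-- Chunk 19b is a chunk of decade 1. [folklore] -/
theorem rank2Rows19b_mem_decade1 : rank2Rows19b ∈ rank2Decade1Chunks :=
  List.mem_iff_getElem?.mpr ⟨19, rfl⟩

end Summit.BirchSwinnertonDyer.BirchSwinnertonDyer.Rank2Observatory
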